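import Literature.AlgebraicGeometry.Resolution.QuasiExcellentSchemesProofs
import Literature.AlgebraicGeometry.Resolution.BlowupReducedDimension
import Mathlib.AlgebraicGeometry.Morphisms.Proper
import Mathlib.AlgebraicGeometry.Noetherian
import HarnessLib

/-!
# `SigmaMaxModifications` (crux stmt-ResolutionOfSingularities-18506, line `Sketch`):
# stub `stub_centreSeq_package` — the package of a blow-up sequence with centres over `T`

Stub `stub_centreSeq_package` of the lead skeleton `Sketch` for the crux
`Summit.ResolutionOfSingularities.ResolutionOfSingularities.Theses.HilbertSamuelElimination.SigmaMaxModifications`.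
Purely structural bookkeeping on the data type `CentreSeq X` of finite sequences of blow-ups
(`Literature/AlgebraicGeometry/Resolution/BlowupSequences.lean`): for a reduced locally
Noetherian scheme `X` of dimension `≤ N` and a sequence `s : CentreSeq X` all of whose centres lie
over `T ⊆ X`,

* the composite `s.comp : s.top ⟶ X` is proper (`CentreSeq.isProper_comp`: blow-ups of locally
  Noetherian schemes are proper);
* `s.top` is reduced (`IsBlowup.isReduced_of_isReduced`, iterated along the sequence:
  `isReduced_top`) and of dimension `≤ N`
  (`IsBlowup.topologicalKrullDim_le_of_isLocallyNoetherian`, iterated: `topologicalKrullDim_top_le`);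
* `s.comp` is an isomorphism over every open `U ⊆ Tᶜ` (`CentreSeq.isIso_comp_morphismRestrict`,
  the centres lying over `T ⊆ Uᶜ`, `CentreSeq.CentresOver.mono`), and the preimage of every dense
  open `U ⊆ Tᶜ` is dense in `s.top` (`CentreSeq.dense_preimage_comp`).

Local Noetherianity propagates along the sequence because each blow-up `blowup.π C` is proper,
hence locally of finite type (`LocallyOfFiniteType.isLocallyNoetherian`), exactly as in the proof
of `CentreSeq.isProper_comp`.
-/

set_option linter.dupNamespace false -- mandated namespace of this single-conjunct summit

noncomputable section

open CategoryTheory AlgebraicGeometry TopologicalSpace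
open Literature.AlgebraicGeometry.Resolution Literature.RingTheory.HilbertSamuel

namespace Summit.ResolutionOfSingularities.ResolutionOfSingularities.Theorems.SigmaMaxModifications.Sketch

universe u

/-! ## Reducedness and dimension along a blow-up sequence -/

/-- **The last scheme of a blow-up sequence over a reduced locally Noetherian scheme is reduced**:
each blow-up of a reduced locally Noetherian scheme is reduced (`IsBlowup.isReduced_of_isReduced`,
CJS Thm. 6.6: "for reduced `X` every `X_i` is reduced") and again locally Noetherian (proper, hence
locally of finite type). [cite: CossartJannsenSaito2020, Thm. 6.6] -/
theorem isReduced_top : ∀ {X : Scheme.{u}} [IsLocallyNoetherian X] [IsReduced X]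
    (s : CentreSeq X), IsReduced s.top
  | X, _, _, .nil _ => show IsReduced X from inferInstance
  | _, _, _, .cons C rest => by
    haveI : IsProper (blowup.π C) := (blowup.isBlowup C).isProper
    haveI : IsLocallyNoetherian (blowup C) := LocallyOfFiniteType.isLocallyNoetherian (blowup.π C)
    haveI : IsReduced (blowup C) := (blowup.isBlowup C).isReduced_of_isReduced
    show IsReduced rest.top
    exact isReduced_top rest

/-- **Blow-up sequences do not raise the dimension**: if `dim X ≤ N` for a locally Noetherian `X`
then `dim s.top ≤ N` (`IsBlowup.topologicalKrullDim_le_of_isLocallyNoetherian` at each step,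
CJS Thm. 3.10 (proof): `dim X' = dim X`). [cite: CossartJannsenSaito2020, Thm. 3.10 (proof)] -/
theorem topologicalKrullDim_top_le : ∀ {X : Scheme.{u}} [IsLocallyNoetherian X] (s : CentreSeq X)
    {N : ℕ}, topologicalKrullDim X ≤ (N : WithBot ℕ∞) → topologicalKrullDim s.top ≤ (N : WithBot ℕ∞)
  | _, _, .nil _, _, h => h
  | _, _, .cons C rest, N, h => by
    haveI : IsProper (blowup.π C) := (blowup.isBlowup C).isProper
    haveI : IsLocallyNoetherian (blowup C) := LocallyOfFiniteType.isLocallyNoetherian (blowup.π C)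
    show topologicalKrullDim rest.top ≤ (N : WithBot ℕ∞)
    exact topologicalKrullDim_top_le rest
      ((blowup.isBlowup C).topologicalKrullDim_le_of_isLocallyNoetherian h)

/-! ## The package -/

/-- **Package of a blow-up sequence with centres over `T`.** For a reduced locally Noetherian
scheme `X` of dimension `≤ N` and a finite sequence of blow-ups `s : CentreSeq X` all of whose
centres lie over `T ⊆ X`: the composite `s.comp : s.top ⟶ X` is proper, `s.top` is reduced of
dimension `≤ N`, `s.comp` is an isomorphism over every open `U ⊆ Tᶜ` (a blow-up is an isomorphism
away from its centre, Stacks 02OS), and the preimage of every dense open `U ⊆ Tᶜ` is dense in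
`s.top`. [cite: StacksProject, Tag 02OS] [cite: CossartJannsenSaito2020, Thm. 6.6] -/
theorem stub_centreSeq_package :
    ∀ (X : Scheme.{0}) [IsLocallyNoetherian X] [IsReduced X] (N : ℕ),
      topologicalKrullDim X ≤ (N : WithBot ℕ∞) → ∀ (T : Set X) (s : CentreSeq X),
      s.CentresOver T →
        IsProper s.comp ∧ IsReduced s.top ∧ topologicalKrullDim s.top ≤ (N : WithBot ℕ∞) ∧
        (∀ U : X.Opens, (U : Set X) ⊆ Tᶜ → IsIso (s.comp ∣_ U)) ∧
        (∀ U : X.Opens, Dense (U : Set X) → (U : Set X) ⊆ Tᶜ →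
          Dense ((s.comp ⁻¹ᵁ U : s.top.Opens) : Set s.top)) := by
  intro X _ _ N hdim T s hs
  refine ⟨s.isProper_comp, isReduced_top s, topologicalKrullDim_top_le s hdim, fun U hU => ?_,
    fun U hd hU => ?_⟩
  · exact s.isIso_comp_morphismRestrict U
      (CentreSeq.CentresOver.mono s (Set.subset_compl_comm.mp hU) hs)
  · exact s.dense_preimage_comp U hd
      (CentreSeq.CentresOver.mono s (Set.subset_compl_comm.mp hU) hs)

end Summit.ResolutionOfSingularities.ResolutionOfSingularities.Theorems.SigmaMaxModifications.Sketch

end
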